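import Literature.Computability.Complexity.CircuitDAG
import HarnessLib

/-!
# Rigidification of symmetric circuits: the reduced form of a DAG circuit
# (Anderson–Dawar 2017, Lemma 7)

Everything PROVED; no named facts. For a DAG circuit `D : GateDAG ι Λ` (file `CircuitDAG.lean`)
all of whose gate functions are symmetric we construct its REDUCED FORM `D.reduce`:

1. identity gates (gate function `∧₁`) are dissolved — every wire is replaced by its CORE, the
   first non-identity gate or input below it (`core`, `coreN`);
2. non-identity gates are identified under SYNTACTIC CONGRUENCE (`Cong`: same gate function and,
   recursively, the same multiset of cores of argument wires up to congruence; classes `CQ`);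
3. multiplicities of argument wires, which a simply wired program cannot express, are realised by
   CHAINS of fresh identity gates `∧₁(w), ∧₁(∧₁(w)), …` (`ChainIdx`), as in the proof of Lemma 7
   (arXiv version, Lemma 24) of Anderson–Dawar.

Theorems: `reduce` computes the same values (`val_reduce_inl`, `evalOut_reduce`), is simply wired
and over the same basis (plus `∧₁`), is REDUCED hence RIGID (`reduced_reduce`,
`CircuitDAG.Reduced.isRigidDAG`), inherits every automorphism of `D` (`IsAut.reduce`), and — the
point of rigidification — its gate orbits are images of the orbits of `D` traced by ANY family of
automorphisms witnessing the symmetry of `D`, the chains on input wires contributing orbits of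
size at most `|ι|` (`ncard_orbit_reduce_le`). The straight-line corollary
`Circuit.exists_rigid_equiv` is the form of `[2, Lemma 7]` consumed by the tree's conditional
proof of Dawar–Wilsenach 2025, Thm. 6.4
(`DawarWilsenach2025_orbitSize_countingWidth.of_rigidification_of_supportTheorem`).

## References

* M. Anderson, A. Dawar, *On symmetric circuits and fixed-point logics*, Theory Comput. Syst. 60
  (2017) 521–551, Lemma 7 and Prop. 9; arXiv:1401.1125, Lemma 24 (the `∧`-chains).
* A. Dawar, G. Wilsenach, *Symmetric arithmetic circuits*, Theory of Computing 21 (2025), p. 18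
  ("any symmetric Boolean circuit over the threshold basis may be converted into an equivalent
  rigid symmetric circuit … the conversion does not increase orbit size").
-/

noncomputable section

open scoped Classical

namespace Literature.Computability.Complexity

open Finset

/-! ### Two functions with the same multiset of values differ by a bijection -/

/-- Two finite families with the same multiset of values differ by a bijection of the index
types. [folklore] -/
theorem exists_equiv_of_map_univ_val_eq {α β γ : Type*} [Fintype α] [Fintype β] (f : α → γ)
    (g : β → γ) (h : (univ : Finset α).val.map f = (univ : Finset β).val.map g) :
    ∃ e : α ≃ β, ∀ a, g (e a) = f a := by
  classical
  have hcard : ∀ c, Fintype.card {a // f a = c} = Fintype.card {b // g b = c} := by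
    intro c
    rw [Fintype.card_subtype, Fintype.card_subtype]
    have h1 : (univ.filter fun a => f a = c).card = ((univ : Finset α).val.map f).count c := by
      rw [Multiset.count_map, ← Finset.filter_val, Finset.card_val]
      congr 1
      exact Finset.filter_congr fun a _ => eq_comm
    have h2 : (univ.filter fun b => g b = c).card = ((univ : Finset β).val.map g).count c := by
      rw [Multiset.count_map, ← Finset.filter_val, Finset.card_val]
      congr 1
      exact Finset.filter_congr fun a _ => eq_comm
    rw [h1, h2, h]
  exact ⟨Equiv.ofFiberEquiv (f := f) (g := g) fun c => Fintype.equivOfCardEq (hcard c),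
    fun a => Equiv.ofFiberEquiv_map _ a⟩

/-- Two tuples whose lists are permutations of each other differ by a bijection of positions.
[folklore] -/
theorem exists_equiv_of_ofFn_perm {γ : Type*} {m n : ℕ} {f : Fin m → γ} {g : Fin n → γ}
    (h : (List.ofFn f).Perm (List.ofFn g)) : ∃ e : Fin m ≃ Fin n, ∀ a, g (e a) = f a := by
  apply exists_equiv_of_map_univ_val_eq
  have h' : ((List.ofFn f : List γ) : Multiset γ) = (List.ofFn g : Multiset γ) := Multiset.coe_eq_coe.2 h
  rwa [← Fin.univ_val_map, ← Fin.univ_val_map] at h'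

/-- Conversely a bijection of positions gives permuted lists. [folklore] -/
theorem ofFn_perm_of_equiv {γ : Type*} {m n : ℕ} {f : Fin m → γ} {g : Fin n → γ}
    (e : Fin m ≃ Fin n) (h : ∀ a, g (e a) = f a) : (List.ofFn f).Perm (List.ofFn g) := by
  rw [← Multiset.coe_eq_coe, ← Fin.univ_val_map, ← Fin.univ_val_map]
  have : f = g ∘ e := funext fun a => (h a).symm
  rw [this, ← Multiset.map_map, Multiset.map_univ_val_equiv]

/-- A supremum over a finite type is invariant under reindexing by a bijection. [folklore] -/
theorem sup_univ_comp_equiv {α β γ : Type*} [Fintype α] [Fintype β] [SemilatticeSup γ] [OrderBot γ]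
    (g : β → γ) (e : α ≃ β) : (univ : Finset α).sup (g ∘ e) = (univ : Finset β).sup g := by
  apply le_antisymm
  · exact Finset.sup_le fun a _ => Finset.le_sup (f := g) (mem_univ (e a))
  · refine Finset.sup_le fun b _ => ?_
    have := Finset.le_sup (f := g ∘ e) (mem_univ (e.symm b))
    rwa [Function.comp_apply, Equiv.apply_symm_apply] at this

/-- The values of the elements of a finset, as a multiset, are the finset. [folklore] -/
theorem univ_val_map_coe_finset {α : Type*} (s : Finset α) :
    (univ : Finset ↥s).val.map Subtype.val = s.val := by
  have h := congrArg Finset.val (Finset.attach_map_val (s := s))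
  rw [Finset.map_val] at h
  rw [Finset.univ_eq_attach]
  exact h

namespace GateDAG

variable {ι Λ : Type*} (D : GateDAG ι Λ)

/-! ### Identity gates and cores of wires -/

/-- An identity gate: its gate function is `∧₁` (the identity on one bit). [cite: AndersonDawar2016, Lemma 7 (proof: the ∧-chains)] -/
def IsIdGate (l : Λ) : Prop := D.fn l = GateFn.and 1

/-- `∧₁` is the identity. [folklore] -/
theorem GateFn.and_one_apply {f : GateFn} (h : f = GateFn.and 1) (v : Fin f.1 → Bool) :
    f.2 v = v ⟨0, h ▸ Nat.one_pos⟩ := by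
  subst h
  change decide (∀ i : Fin 1, v i = true) = v ⟨0, Nat.one_pos⟩
  have : (∀ i : Fin 1, v i = true) ↔ v ⟨0, Nat.one_pos⟩ = true :=
    ⟨fun h => h _, fun h i => by rwa [Fin.fin_one_eq_zero i]⟩
  rw [decide_eq_decide.2 this, Bool.decide_eq_true]

/-- The argument position of an identity gate. [folklore] -/
def idIdx {l : Λ} (h : D.IsIdGate l) : Fin (D.fn l).1 := ⟨0, by rw [h]; exact Nat.one_pos⟩

/-- An identity gate has exactly one argument position. [folklore] -/
theorem eq_idIdx {l : Λ} (h : D.IsIdGate l) (a : Fin (D.fn l).1) : a = D.idIdx h := by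
  apply Fin.ext
  have : (D.fn l).1 = 1 := by rw [h]; rfl
  have ha := a.2
  simp only [idIdx]
  omega

/-- The value of an identity gate is the value of its argument wire. [folklore] -/
theorem val_of_isIdGate {l : Λ} (h : D.IsIdGate l) (x : ι → Bool) :
    D.val x l = wire x (D.val x) (D.args l (D.idIdx h)) := by
  rw [D.val_eq, GateFn.and_one_apply h]
  rfl

/-- The core of a gate: follow identity gates down to the first non-identity gate or input.
[cite: AndersonDawar2016, Lemma 7 (proof)] -/
def coreGate : Λ → ι ⊕ Λ :=
  D.wf.fix fun l rec =>
    if h : D.IsIdGate l then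
      match hw : D.args l (D.idIdx h) with
      | .inl i => .inl i
      | .inr m => rec m ⟨_, hw⟩
    else .inr l

/-- The core of a wire. [cite: AndersonDawar2016, Lemma 7 (proof)] -/
def core : ι ⊕ Λ → ι ⊕ Λ
  | .inl i => .inl i
  | .inr l => D.coreGate l

/-- The core of an input wire is itself. [folklore] -/
@[simp] theorem core_inl (i : ι) : D.core (Sum.inl i) = Sum.inl i := rfl

/-- The core of a gate wire is the core of the gate. [folklore] -/
@[simp] theorem core_inr (l : Λ) : D.core (Sum.inr l) = D.coreGate l := rfl

/-- The core of an identity gate is the core of its argument. [folklore] -/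
theorem coreGate_of_isIdGate {l : Λ} (h : D.IsIdGate l) :
    D.coreGate l = D.core (D.args l (D.idIdx h)) := by
  rw [coreGate, WellFounded.fix_eq, dif_pos h]
  split <;> rename_i hw
  · rw [hw]; rfl
  · conv_rhs => rw [hw]
    rfl

/-- The core of a non-identity gate is itself. [folklore] -/
theorem coreGate_of_not_isIdGate {l : Λ} (h : ¬ D.IsIdGate l) : D.coreGate l = Sum.inr l := by
  rw [coreGate, WellFounded.fix_eq, dif_neg h]

/-- A core is never an identity gate. [folklore] -/
theorem not_isIdGate_of_coreGate_eq (l : Λ) : ∀ {m : Λ}, D.coreGate l = Sum.inr m → ¬ D.IsIdGate m := by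
  induction l using D.wf.induction with
  | _ l ih =>
    intro m hm
    by_cases h : D.IsIdGate l
    · rw [D.coreGate_of_isIdGate h] at hm
      cases hw : D.args l (D.idIdx h) with
      | inl i => rw [hw] at hm; exact absurd hm Sum.inl_ne_inr
      | inr m' => rw [hw, core_inr] at hm; exact ih m' ⟨_, hw⟩ hm
    · rw [D.coreGate_of_not_isIdGate h, Sum.inr.injEq] at hm
      rw [← hm]; exact h

/-- A core is never an identity gate. [folklore] -/
theorem not_isIdGate_of_core_eq {w : ι ⊕ Λ} {m : Λ} (h : D.core w = Sum.inr m) : ¬ D.IsIdGate m := by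
  cases w with
  | inl i => exact absurd h Sum.inl_ne_inr
  | inr l => exact D.not_isIdGate_of_coreGate_eq l h

/-- Taking cores does not change values (identity gates are identities). [folklore] -/
theorem wire_core (x : ι → Bool) (w : ι ⊕ Λ) : wire x (D.val x) (D.core w) = wire x (D.val x) w := by
  cases w with
  | inl i => rfl
  | inr l =>
    rw [core_inr]
    induction l using D.wf.induction with
    | _ l ih =>
      by_cases h : D.IsIdGate l
      · rw [D.coreGate_of_isIdGate h, wire_inr, D.val_of_isIdGate h]
        cases hw : D.args l (D.idIdx h) with
        | inl i => rfl
        | inr m => rw [core_inr]; exact ih m ⟨_, hw⟩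
      · rw [D.coreGate_of_not_isIdGate h]

/-- The height of the core of an argument wire is below the height of the gate. [folklore] -/
theorem height_lt_of_core_args {l m : Λ} {a : Fin (D.fn l).1} (h : D.core (D.args l a) = Sum.inr m) :
    D.height m < D.height l := by
  have key : ∀ (l' : Λ) (m : Λ), D.coreGate l' = Sum.inr m → D.height m ≤ D.height l' := by
    intro l'
    induction l' using D.wf.induction with
    | _ l' ih =>
      intro m hm
      by_cases hid : D.IsIdGate l'
      · rw [D.coreGate_of_isIdGate hid] at hm
        cases hw : D.args l' (D.idIdx hid) with
        | inl i => rw [hw] at hm; exact absurd hm Sum.inl_ne_inr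
        | inr m' =>
          rw [hw, core_inr] at hm
          exact (ih m' ⟨_, hw⟩ m hm).trans (D.height_lt_of_child ⟨_, hw⟩).le
      · rw [D.coreGate_of_not_isIdGate hid, Sum.inr.injEq] at hm
        rw [hm]
  cases hw : D.args l a with
  | inl i => rw [hw] at h; exact absurd h Sum.inl_ne_inr
  | inr m' =>
    rw [hw, core_inr] at h
    exact (key m' m h).trans_lt (D.height_lt_of_child ⟨a, hw⟩)

/-! ### Syntactic congruence -/

/-- Lift of a relation on gates to wires: inputs are related iff equal. [folklore] -/
def WRel (R : Λ → Λ → Prop) : ι ⊕ Λ → ι ⊕ Λ → Prop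
  | .inl i, .inl i' => i = i'
  | .inr m, .inr m' => R m m'
  | .inl _, .inr _ => False
  | .inr _, .inl _ => False

/-- `WRel` is monotone. [folklore] -/
theorem WRel.mono {R R' : Λ → Λ → Prop} (h : ∀ m m', R m m' → R' m m') :
    ∀ {w w' : ι ⊕ Λ}, WRel R w w' → WRel R' w w'
  | .inl _, .inl _, hw => hw
  | .inr _, .inr _, hw => h _ _ hw
  | .inl _, .inr _, hw => hw
  | .inr _, .inl _, hw => hw

/-- Congruence up to depth `h`: same gate function and a bijection of argument positions matching
the cores of the argument wires up to depth `h - 1`. [cite: AndersonDawar2016, Lemma 7 (proof)] -/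
def CongH (h : ℕ) (l l' : Λ) : Prop :=
  match h with
  | 0 => False
  | h + 1 => D.fn l = D.fn l' ∧ ∃ e : Fin (D.fn l).1 ≃ Fin (D.fn l').1,
      ∀ a, WRel (CongH h) (D.core (D.args l a)) (D.core (D.args l' (e a)))

/-- **Syntactic congruence** of gates: congruent up to some depth. Two gates are congruent iff
they have the same gate function and their argument wires, resolved to cores, match under a
bijection of positions, recursively (`cong_iff`). [cite: AndersonDawar2016, Def. 8 / Lemma 7 (proof)] -/
def Cong (l l' : Λ) : Prop := ∃ h, D.CongH h l l'

/-- `CongH` at a successor depth, unfolded. [folklore] -/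
theorem congH_succ_iff (h : ℕ) (l l' : Λ) :
    D.CongH (h + 1) l l' ↔ D.fn l = D.fn l' ∧ ∃ e : Fin (D.fn l).1 ≃ Fin (D.fn l').1,
      ∀ a, WRel (D.CongH h) (D.core (D.args l a)) (D.core (D.args l' (e a))) := Iff.rfl

/-- `CongH` is monotone in the depth. [folklore] -/
theorem congH_mono {h h' : ℕ} (hle : h ≤ h') : ∀ {l l' : Λ}, D.CongH h l l' → D.CongH h' l l' := by
  induction h' generalizing h with
  | zero =>
    intro l l' hc
    obtain rfl : h = 0 := Nat.le_zero.1 hle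
    exact hc
  | succ h' ih =>
    intro l l' hc
    cases h with
    | zero => exact hc.elim
    | succ h =>
      obtain ⟨hfn, e, he⟩ := hc
      exact ⟨hfn, e, fun a => WRel.mono (fun m m' hm => ih (Nat.succ_le_succ_iff.1 hle) hm) (he a)⟩

/-- **Unfolding of congruence.** [cite: AndersonDawar2016, Def. 8] -/
theorem cong_iff (l l' : Λ) :
    D.Cong l l' ↔ D.fn l = D.fn l' ∧ ∃ e : Fin (D.fn l).1 ≃ Fin (D.fn l').1,
      ∀ a, WRel D.Cong (D.core (D.args l a)) (D.core (D.args l' (e a))) := by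
  constructor
  · rintro ⟨h, hc⟩
    cases h with
    | zero => exact hc.elim
    | succ h =>
      obtain ⟨hfn, e, he⟩ := hc
      exact ⟨hfn, e, fun a => WRel.mono (fun m m' hm => ⟨h, hm⟩) (he a)⟩
  · rintro ⟨hfn, e, he⟩
    -- a common depth
    have : ∀ a, ∃ h, WRel (D.CongH h) (D.core (D.args l a)) (D.core (D.args l' (e a))) := by
      intro a
      have ha := he a
      generalize D.core (D.args l a) = w at ha ⊢
      generalize D.core (D.args l' (e a)) = w' at ha ⊢
      cases w with
      | inl i =>
        cases w' with
        | inl i' => exact ⟨0, ha⟩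
        | inr m' => exact ha.elim
      | inr m =>
        cases w' with
        | inl i' => exact ha.elim
        | inr m' => obtain ⟨h, hh⟩ := ha; exact ⟨h, hh⟩
    choose hs hhs using this
    exact ⟨univ.sup hs + 1, hfn, e, fun a =>
      WRel.mono (fun m m' hm => D.congH_mono (Finset.le_sup (f := hs) (mem_univ a)) hm) (hhs a)⟩

/-- Congruence is reflexive. [folklore] -/
theorem cong_refl (l : Λ) : D.Cong l l := by
  induction hn : D.height l using Nat.strong_induction_on generalizing l with
  | _ n ih =>
    rw [cong_iff]
    refine ⟨rfl, Equiv.refl _, fun a => ?_⟩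
    show WRel D.Cong (D.core (D.args l a)) (D.core (D.args l a))
    cases hw : D.core (D.args l a) with
    | inl i => exact rfl
    | inr m => exact ih _ (hn ▸ D.height_lt_of_core_args hw) m rfl

/-- Congruence is symmetric. [folklore] -/
theorem congH_symm {h : ℕ} : ∀ {l l' : Λ}, D.CongH h l l' → D.CongH h l' l := by
  induction h with
  | zero => intro l l' hc; exact hc.elim
  | succ h ih =>
    rintro l l' ⟨hfn, e, he⟩
    refine ⟨hfn.symm, e.symm, fun a => ?_⟩
    have := he (e.symm a)
    rw [Equiv.apply_symm_apply] at this
    generalize D.core (D.args l (e.symm a)) = w at this ⊢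
    generalize D.core (D.args l' a) = w' at this ⊢
    cases w with
    | inl i =>
      cases w' with
      | inl i' => exact (this : i = i').symm
      | inr m' => exact this.elim
    | inr m =>
      cases w' with
      | inl i' => exact this.elim
      | inr m' => exact ih this

/-- Congruence is symmetric. [folklore] -/
theorem cong_symm {l l' : Λ} (h : D.Cong l l') : D.Cong l' l := by
  obtain ⟨n, hn⟩ := h; exact ⟨n, D.congH_symm hn⟩

/-- Congruence is transitive. [folklore] -/
theorem congH_trans {h : ℕ} : ∀ {l l' l'' : Λ}, D.CongH h l l' → D.CongH h l' l'' → D.CongH h l l'' := by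
  induction h with
  | zero => intro l l' l'' hc; exact hc.elim
  | succ h ih =>
    rintro l l' l'' ⟨hfn, e, he⟩ ⟨hfn', e', he'⟩
    refine ⟨hfn.trans hfn', e.trans e', fun a => ?_⟩
    have h1 := he a
    have h2 := he' (e a)
    rw [Equiv.trans_apply]
    generalize D.core (D.args l a) = w at h1 ⊢
    generalize D.core (D.args l' (e a)) = w' at h1 h2 ⊢
    generalize D.core (D.args l'' (e' (e a))) = w'' at h2 ⊢
    cases w with
    | inl i =>
      cases w' with
      | inl i' =>
        cases w'' with
        | inl i'' => exact (h1 : i = i').trans h2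
        | inr m'' => exact h2.elim
      | inr m' => exact h1.elim
    | inr m =>
      cases w' with
      | inl i' => exact h1.elim
      | inr m' =>
        cases w'' with
        | inl i'' => exact h2.elim
        | inr m'' => exact ih h1 h2

/-- Congruence is transitive. [folklore] -/
theorem cong_trans {l l' l'' : Λ} (h : D.Cong l l') (h' : D.Cong l' l'') : D.Cong l l'' := by
  obtain ⟨n, hn⟩ := h
  obtain ⟨n', hn'⟩ := h'
  exact ⟨max n n', D.congH_trans (D.congH_mono (le_max_left _ _) hn) (D.congH_mono (le_max_right _ _) hn')⟩

/-- The congruence setoid on gates. [cite: AndersonDawar2016, Def. 8] -/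
def congSetoid : Setoid Λ := ⟨D.Cong, D.cong_refl, D.cong_symm, D.cong_trans⟩

/-- Congruent gates have the same gate function. [folklore] -/
theorem Cong.fn_eq {l l' : Λ} (h : D.Cong l l') : D.fn l = D.fn l' := ((D.cong_iff l l').1 h).1

/-- **Congruent gates compute the same values** (all gate functions symmetric). [cite: AndersonDawar2016, Lemma 7 (proof)] -/
theorem Cong.val_eq (hsym : ∀ l, (D.fn l).IsSymmetric) (x : ι → Bool) :
    ∀ {l l' : Λ}, D.Cong l l' → D.val x l = D.val x l' := by
  suffices ∀ (h : ℕ) (l l' : Λ), D.CongH h l l' → D.val x l = D.val x l' from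
    fun l l' hc => hc.elim fun h hh => this h l l' hh
  intro h
  induction h with
  | zero => intro l l' hc; exact hc.elim
  | succ h ih =>
    rintro l l' ⟨hfn, e, he⟩
    rw [D.val_eq, D.val_eq]
    refine GateFn.apply_eq_of_eq hfn (hsym l') ?_
    have hpt : ∀ a, wire x (D.val x) (D.args l a) = wire x (D.val x) (D.args l' (e a)) := by
      intro a
      have ha := he a
      rw [← D.wire_core x (D.args l a), ← D.wire_core x (D.args l' (e a))]
      generalize D.core (D.args l a) = w at ha ⊢
      generalize D.core (D.args l' (e a)) = w' at ha ⊢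
      cases w with
      | inl i =>
        cases w' with
        | inl i' => rw [(ha : i = i')]
        | inr m' => exact ha.elim
      | inr m =>
        cases w' with
        | inl i' => exact ha.elim
        | inr m' => exact ih m m' ha
    have hfun : (fun a => wire x (D.val x) (D.args l a)) =
        fun a => (fun b => wire x (D.val x) (D.args l' b)) (e a) := funext hpt
    rw [hfun]
    exact Circuit.numOnes_eq_of_perm_map (a := ⇑e) (a' := _root_.id) (F := _root_.id)
      (u := fun b => wire x (D.val x) (D.args l' b)) (u' := fun b => wire x (D.val x) (D.args l' b))
      (by rw [List.map_id]; exact ofFn_perm_of_equiv e fun a => rfl) (fun i => rfl)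

/-! ### Non-identity gates, congruence classes, child multisets -/

/-- The non-identity gates of `D`. [folklore] -/
abbrev NI : Type _ := {l : Λ // ¬ D.IsIdGate l}

/-- The core of a wire, as an input or a NON-IDENTITY gate. [cite: AndersonDawar2016, Lemma 7 (proof)] -/
def coreN (w : ι ⊕ Λ) : ι ⊕ D.NI :=
  match h : D.core w with
  | .inl i => .inl i
  | .inr m => .inr ⟨m, D.not_isIdGate_of_core_eq h⟩

/-- Forgetting that cores are non-identity gates. [folklore] -/
theorem map_val_coreN (w : ι ⊕ Λ) : Sum.map _root_.id Subtype.val (D.coreN w) = D.core w := by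
  unfold coreN
  split <;> rename_i h
  · rw [h]; rfl
  · exact h.symm

/-- Congruence restricted to non-identity gates. [cite: AndersonDawar2016, Def. 8] -/
def congSetoidN : Setoid D.NI := D.congSetoid.comap Subtype.val

/-- **The congruence classes** of non-identity gates — the gates of the reduced circuit that come
from `D`. [cite: AndersonDawar2016, Lemma 7 (proof)] -/
abbrev CQ : Type _ := Quotient D.congSetoidN

/-- The class of a non-identity gate. [folklore] -/
abbrev cls (l : D.NI) : D.CQ := Quotient.mk D.congSetoidN l

/-- Two non-identity gates have the same class iff they are congruent. [folklore] -/
theorem cls_eq_cls_iff (l l' : D.NI) : D.cls l = D.cls l' ↔ D.Cong l.1 l'.1 :=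
  ⟨fun h => Quotient.exact h, fun h => Quotient.sound h⟩

/-- A class is the class of its chosen representative. [folklore] -/
theorem cong_out (l : D.NI) : D.Cong ((D.cls l).out).1 l.1 := Quotient.mk_out (s := D.congSetoidN) l

/-- Wires of the reduced circuit before chains: inputs and classes. The class wire of a wire of
`D` is the class of its core. [folklore] -/
def qw : ι ⊕ D.NI → ι ⊕ D.CQ := Sum.map _root_.id D.cls

/-- The class of the core of a wire. [folklore] -/
def qcore (w : ι ⊕ Λ) : ι ⊕ D.CQ := D.qw (D.coreN w)

/-- Matching of cores under congruence is equality of class wires. [folklore] -/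
theorem wrel_cong_core_iff (w w' : ι ⊕ Λ) :
    WRel D.Cong (D.core w) (D.core w') ↔ D.qcore w = D.qcore w' := by
  rw [← D.map_val_coreN w, ← D.map_val_coreN w']
  unfold qcore qw
  generalize D.coreN w = c
  generalize D.coreN w' = c'
  rcases c with i | ⟨m, hm⟩ <;> rcases c' with i' | ⟨m', hm'⟩
  · simp only [Sum.map_inl, id_eq, Sum.inl.injEq]; exact Iff.rfl
  · simp only [Sum.map_inl, Sum.map_inr]; exact ⟨fun h => h.elim, fun h => Sum.inl_ne_inr h⟩
  · simp only [Sum.map_inl, Sum.map_inr]; exact ⟨fun h => h.elim, fun h => Sum.inr_ne_inl h⟩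
  · simp only [Sum.map_inr, Sum.inr.injEq]
    rw [cls_eq_cls_iff]
    exact Iff.rfl

/-- **The child multiset** of a gate: the class wires of the cores of its argument wires, with
multiplicity. [cite: AndersonDawar2016, Lemma 7 (proof)] -/
def cm (l : Λ) : Multiset (ι ⊕ D.CQ) := (univ : Finset (Fin (D.fn l).1)).val.map fun a => D.qcore (D.args l a)

/-- The child multiset has one entry per argument position. [folklore] -/
theorem card_cm (l : Λ) : Multiset.card (D.cm l) = (D.fn l).1 := by
  rw [cm, Multiset.card_map, Finset.card_val, Finset.card_fin]

/-- **Congruence is: same gate function and same child multiset.** [cite: AndersonDawar2016, Def. 8] -/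
theorem cong_iff_cm (l l' : Λ) : D.Cong l l' ↔ D.fn l = D.fn l' ∧ D.cm l = D.cm l' := by
  rw [cong_iff]
  refine and_congr_right fun hfn => ⟨?_, ?_⟩
  · rintro ⟨e, he⟩
    have hfun : (fun a => D.qcore (D.args l a)) = (fun b => D.qcore (D.args l' b)) ∘ e :=
      funext fun a => (D.wrel_cong_core_iff _ _).1 (he a)
    rw [cm, cm, hfun, ← Multiset.map_map, Multiset.map_univ_val_equiv]
  · intro h
    obtain ⟨e, he⟩ := exists_equiv_of_map_univ_val_eq _ _ h
    exact ⟨e, fun a => (D.wrel_cong_core_iff _ _).2 (he a).symm⟩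

/-- Congruent gates have the same child multiset. [folklore] -/
theorem Cong.cm_eq {l l' : Λ} (h : D.Cong l l') : D.cm l = D.cm l' := ((D.cong_iff_cm l l').1 h).2

/-- The gate function of a class (read off the chosen representative). [folklore] -/
def fnQ (q : D.CQ) : GateFn := D.fn q.out.1

/-- The child multiset of a class. [folklore] -/
def cmQ (q : D.CQ) : Multiset (ι ⊕ D.CQ) := D.cm q.out.1

/-- The gate function of the class of `l` is that of `l`. [folklore] -/
theorem fnQ_cls (l : D.NI) : D.fnQ (D.cls l) = D.fn l.1 := (D.cong_out l).fn_eq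

/-- The child multiset of the class of `l` is that of `l`. [folklore] -/
theorem cmQ_cls (l : D.NI) : D.cmQ (D.cls l) = D.cm l.1 := (D.cong_out l).cm_eq

/-- The class gate function is not `∧₁`. [folklore] -/
theorem fnQ_ne (q : D.CQ) : D.fnQ q ≠ GateFn.and 1 := q.out.2

/-- The child multiset of a class has one entry per argument position. [folklore] -/
theorem card_cmQ (q : D.CQ) : Multiset.card (D.cmQ q) = (D.fnQ q).1 := D.card_cm _

/-! ### Core height (a congruence-invariant rank) -/

/-- The core height of a gate: one more than the maximal core height of the core of an argument
wire (`0` if all cores are inputs). Unlike `height` it is invariant under congruence. [folklore] -/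
def chgt : Λ → ℕ :=
  (InvImage.wf D.height wellFounded_lt).fix fun l rec => univ.sup fun a : Fin (D.fn l).1 =>
    match h : D.core (D.args l a) with
    | .inl _ => 0
    | .inr m => rec m (D.height_lt_of_core_args h) + 1

/-- The defining equation of `chgt`. [folklore] -/
theorem chgt_eq (l : Λ) : D.chgt l = univ.sup fun a : Fin (D.fn l).1 =>
    Sum.elim (fun _ => 0) (fun m => D.chgt m + 1) (D.core (D.args l a)) := by
  show WellFounded.fix _ _ l = _
  rw [WellFounded.fix_eq]
  refine congrArg univ.sup (funext fun a => ?_)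
  split <;> rename_i h
  · simp [h]
  · simp only [h, Sum.elim_inr]; rfl

/-- Cores of argument wires have smaller core height. [folklore] -/
theorem chgt_lt_of_core_args {l m : Λ} {a : Fin (D.fn l).1} (h : D.core (D.args l a) = Sum.inr m) :
    D.chgt m < D.chgt l := by
  rw [D.chgt_eq l]
  have : D.chgt m + 1 ≤ univ.sup fun a : Fin (D.fn l).1 =>
      Sum.elim (fun _ => 0) (fun m => D.chgt m + 1) (D.core (D.args l a)) := by
    refine le_trans ?_ (Finset.le_sup (f := fun a : Fin (D.fn l).1 =>
      Sum.elim (fun _ => 0) (fun m => D.chgt m + 1) (D.core (D.args l a))) (mem_univ a))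
    simp [h]
  omega

/-- Core height is invariant under congruence. [folklore] -/
theorem Cong.chgt_eq : ∀ {l l' : Λ}, D.Cong l l' → D.chgt l = D.chgt l' := by
  suffices ∀ (n : ℕ) (l l' : Λ), D.chgt l = n → D.Cong l l' → D.chgt l = D.chgt l' from
    fun l l' h => this _ l l' rfl h
  intro n
  induction n using Nat.strong_induction_on with
  | _ n ih =>
    intro l l' hn hc
    obtain ⟨hfn, e, he⟩ := (D.cong_iff l l').1 hc
    rw [D.chgt_eq l, D.chgt_eq l']
    have hpt : ∀ a, Sum.elim (fun _ => 0) (fun m => D.chgt m + 1) (D.core (D.args l a)) =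
        Sum.elim (fun _ => 0) (fun m => D.chgt m + 1) (D.core (D.args l' (e a))) := by
      intro a
      have ha := he a
      cases hw : D.core (D.args l a) with
      | inl i =>
        rw [hw] at ha
        cases hw' : D.core (D.args l' (e a)) with
        | inl i' => rfl
        | inr m' => rw [hw'] at ha; exact ha.elim
      | inr m =>
        rw [hw] at ha
        cases hw' : D.core (D.args l' (e a)) with
        | inl i' => rw [hw'] at ha; exact ha.elim
        | inr m' =>
          rw [hw'] at ha
          simp only [Sum.elim_inr, add_left_inj]
          exact ih _ (hn ▸ D.chgt_lt_of_core_args hw) m m' rfl ha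
    have hfun : (fun a => Sum.elim (fun _ => 0) (fun m => D.chgt m + 1) (D.core (D.args l a))) =
        (fun b => Sum.elim (fun _ => 0) (fun m => D.chgt m + 1) (D.core (D.args l' b))) ∘ e :=
      funext hpt
    rw [hfun]
    exact sup_univ_comp_equiv _ e

/-- The core height of a class. [folklore] -/
def chQ (q : D.CQ) : ℕ := D.chgt q.out.1

/-- The core height of the class of `l` is that of `l`. [folklore] -/
theorem chQ_cls (l : D.NI) : D.chQ (D.cls l) = D.chgt l.1 := (D.cong_out l).chgt_eq

/-- Class wires occurring in the child multiset of `q` have smaller core height. [folklore] -/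
theorem chQ_lt_of_mem_cmQ {q q' : D.CQ} (h : Sum.inr q' ∈ D.cmQ q) : D.chQ q' < D.chQ q := by
  unfold cmQ cm at h
  rw [Multiset.mem_map] at h
  obtain ⟨a, -, ha⟩ := h
  unfold qcore qw at ha
  have hc := D.map_val_coreN (D.args q.out.1 a)
  revert ha hc
  generalize D.coreN (D.args q.out.1 a) = c
  rcases c with i | m
  · intro ha; exact absurd ha Sum.inl_ne_inr
  · intro ha hc
    simp only [Sum.map_inr, Sum.inr.injEq] at ha hc
    rw [← ha, chQ_cls]
    exact D.chgt_lt_of_core_args hc.symm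

/-! ### Pairs of a multiset -/

/-- The pairs `(w, k)`, `k <` multiplicity of `w`, of a multiset. [folklore] -/
def pairsFS (s : Multiset (ι ⊕ D.CQ)) : Finset ((ι ⊕ D.CQ) × ℕ) :=
  s.toFinset.biUnion fun w => (range (s.count w)).image fun k => (w, k)

/-- Membership in `pairsFS`. [folklore] -/
theorem mem_pairsFS {s : Multiset (ι ⊕ D.CQ)} {p : (ι ⊕ D.CQ) × ℕ} : p ∈ D.pairsFS s ↔ p.2 < s.count p.1 := by
  unfold pairsFS
  rw [Finset.mem_biUnion]
  constructor
  · rintro ⟨w, -, hw⟩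
    rw [Finset.mem_image] at hw
    obtain ⟨k, hk, rfl⟩ := hw
    exact Finset.mem_range.1 hk
  · intro h
    refine ⟨p.1, ?_, ?_⟩
    · rw [Multiset.mem_toFinset, ← Multiset.count_pos]; omega
    · rw [Finset.mem_image]
      exact ⟨p.2, Finset.mem_range.2 h, rfl⟩

/-- `pairsFS` has as many elements as the multiset. [folklore] -/
theorem card_pairsFS (s : Multiset (ι ⊕ D.CQ)) : (D.pairsFS s).card = Multiset.card s := by
  unfold pairsFS
  rw [Finset.card_biUnion]
  · rw [← Multiset.toFinset_sum_count_eq]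
    refine Finset.sum_congr rfl fun w _ => ?_
    rw [Finset.card_image_of_injective _ (fun k k' h => (Prod.mk.inj h).2), Finset.card_range]
  · intro w _ w' _ hne
    rw [Function.onFun, Finset.disjoint_left]
    intro p hp hp'
    rw [Finset.mem_image] at hp hp'
    obtain ⟨k, -, rfl⟩ := hp
    obtain ⟨k', -, h⟩ := hp'
    exact hne (Prod.mk.inj h).1.symm

/-- `pairsFS` determines the multiset. [folklore] -/
theorem pairsFS_injective : Function.Injective D.pairsFS := by
  intro s t h
  ext w
  have key : ∀ k, k < s.count w ↔ k < t.count w := fun k => by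
    rw [← D.mem_pairsFS (p := (w, k)), ← D.mem_pairsFS (p := (w, k)), h]
  exact le_antisymm (not_lt.1 fun hlt => (lt_irrefl _ ((key _).1 hlt)))
    (not_lt.1 fun hlt => (lt_irrefl _ ((key _).2 hlt)))

/-- The first components of `pairsFS s` recover `s`. [folklore] -/
theorem map_fst_pairsFS (s : Multiset (ι ⊕ D.CQ)) : (D.pairsFS s).val.map Prod.fst = s := by
  ext w
  rw [Multiset.count_map]
  have : (Multiset.filter (fun p : (ι ⊕ D.CQ) × ℕ => w = p.1) (D.pairsFS s).val) =
      ((range (s.count w)).image fun k => (w, k)).val := by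
    rw [← Finset.filter_val]
    congr 1
    ext p
    rw [Finset.mem_filter, mem_pairsFS, Finset.mem_image]
    constructor
    · rintro ⟨h, rfl⟩
      exact ⟨p.2, Finset.mem_range.2 h, rfl⟩
    · rintro ⟨k, hk, rfl⟩
      exact ⟨Finset.mem_range.1 hk, rfl⟩
  rw [this, Finset.card_val, Finset.card_image_of_injective _ (fun k k' h => (Prod.mk.inj h).2),
    Finset.card_range]

section Reduce

variable [Fintype Λ]

/-! ### Multiplicities and chains -/

/-- The maximal multiplicity with which the wire `w` feeds a class. [cite: AndersonDawar2016, Lemma 7 (proof: the ∧-chains)] -/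
def mult (w : ι ⊕ D.CQ) : ℕ := univ.sup fun q : D.CQ => (D.cmQ q).count w

/-- Multiplicities in a child multiset are bounded by `mult`. [folklore] -/
theorem count_le_mult (q : D.CQ) (w : ι ⊕ D.CQ) : (D.cmQ q).count w ≤ D.mult w :=
  Finset.le_sup (f := fun q : D.CQ => (D.cmQ q).count w) (mem_univ q)

/-- A uniform bound on all multiplicities (the maximal fan-in, plus one). [folklore] -/
def multBound : ℕ := univ.sup (fun q : D.CQ => Multiset.card (D.cmQ q)) + 1

/-- `mult w < multBound`. [folklore] -/
theorem mult_lt_multBound (w : ι ⊕ D.CQ) : D.mult w < D.multBound := by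
  apply Nat.lt_succ_of_le
  refine Finset.sup_le fun q _ => le_trans (Multiset.count_le_card _ _) ?_
  exact Finset.le_sup (f := fun q : D.CQ => Multiset.card (D.cmQ q)) (mem_univ q)

/-- **Chain gates**: `⟨w, k⟩` with `1 ≤ k < mult w` is the `k`-th identity gate `∧₁(∧₁(⋯ w))`
above the wire `w`. [cite: AndersonDawar2016, Lemma 7 (proof: the ∧-chains)] -/
abbrev ChainIdx : Type _ := (w : ι ⊕ D.CQ) × {k : Fin (D.mult w) // 1 ≤ (k : ℕ)}

/-- **The gates of the reduced circuit**: congruence classes and chain gates. [cite: AndersonDawar2016, Lemma 7 (proof)] -/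
abbrev RGate : Type _ := D.CQ ⊕ D.ChainIdx

/-- A class wire as a wire of the reduced circuit. [folklore] -/
def embed : ι ⊕ D.CQ → ι ⊕ D.RGate := Sum.map _root_.id Sum.inl

/-- `embed` is injective. [folklore] -/
theorem embed_injective : Function.Injective D.embed :=
  Sum.map_injective.2 ⟨Function.injective_id, Sum.inl_injective⟩

/-- The `k`-th copy of the wire `w`: `w` itself for `k = 0`, the chain gate `⟨w, k⟩` for
`1 ≤ k < mult w` (and, irrelevantly, `w` again beyond). [cite: AndersonDawar2016, Lemma 7 (proof)] -/
def chainWire (w : ι ⊕ D.CQ) (k : ℕ) : ι ⊕ D.RGate :=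
  if h : 1 ≤ k ∧ k < D.mult w then .inr (.inr ⟨w, ⟨k, h.2⟩, h.1⟩) else D.embed w

/-- The zeroth copy is the wire itself. [folklore] -/
theorem chainWire_zero (w : ι ⊕ D.CQ) : D.chainWire w 0 = D.embed w := by
  unfold chainWire; rw [dif_neg]; omega

/-- The copies in range are chain gates. [folklore] -/
theorem chainWire_of_lt {w : ι ⊕ D.CQ} {k : ℕ} (h1 : 1 ≤ k) (h2 : k < D.mult w) :
    D.chainWire w k = .inr (.inr ⟨w, ⟨k, h2⟩, h1⟩) := by
  unfold chainWire; rw [dif_pos ⟨h1, h2⟩]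

/-- `chainWire` is injective on pairs in range. [folklore] -/
theorem chainWire_inj {w w' : ι ⊕ D.CQ} {k k' : ℕ} (hk : k < D.mult w ∨ k = 0) (hk' : k' < D.mult w' ∨ k' = 0)
    (h : D.chainWire w k = D.chainWire w' k') : w = w' ∧ k = k' := by
  rcases Nat.eq_zero_or_pos k with rfl | hk0 <;> rcases Nat.eq_zero_or_pos k' with rfl | hk0'
  · rw [chainWire_zero, chainWire_zero] at h
    exact ⟨D.embed_injective h, rfl⟩
  · rw [chainWire_zero, D.chainWire_of_lt hk0' (hk'.resolve_right (by omega))] at h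
    cases w <;> simp [embed] at h
  · rw [chainWire_zero, D.chainWire_of_lt hk0 (hk.resolve_right (by omega))] at h
    cases w' <;> simp [embed] at h
  · rw [D.chainWire_of_lt hk0 (hk.resolve_right (by omega)),
      D.chainWire_of_lt hk0' (hk'.resolve_right (by omega))] at h
    simp only [Sum.inr.injEq] at h
    rw [Sigma.mk.injEq] at h
    obtain ⟨rfl, h2⟩ := h
    simp only [heq_eq_eq, Subtype.mk.injEq] at h2
    exact ⟨rfl, congrArg Fin.val h2⟩

/-- The argument positions of a class are in bijection with the pairs of its child multiset.
[folklore] -/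
def argEquiv (q : D.CQ) : Fin (D.fnQ q).1 ≃ ↥(D.pairsFS (D.cmQ q)) :=
  (Fintype.equivFinOfCardEq (by rw [Fintype.card_coe, card_pairsFS, card_cmQ])).symm

/-! ### The reduced circuit -/

/-- Rank of a class wire (for acyclicity of the reduced circuit). [folklore] -/
def wrank : ι ⊕ D.CQ → ℕ
  | .inl _ => 0
  | .inr q => D.chQ q + 1

/-- Rank of a gate of the reduced circuit. [folklore] -/
def rrank : D.RGate → ℕ
  | .inl q => D.multBound * (D.chQ q + 1)
  | .inr c => D.multBound * D.wrank c.1 + c.2.1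

/-- **The reduced circuit** `D.reduce` of `D`: a class `q` becomes a gate with the gate function
of `q`, reading, for each wire `w` of multiplicity `c` in the child multiset of `q`, the `c`
distinct wires `w, ∧₁(w), …, ∧₁^{c-1}(w)`; the chain gate `⟨w, k⟩` is `∧₁` applied to the
`(k-1)`-st copy of `w`; the output is the class wire of the core of the output of `D`.
[cite: AndersonDawar2016, Lemma 7 (proof)] -/
def reduce : GateDAG ι D.RGate where
  fn
    | .inl q => D.fnQ q
    | .inr _ => GateFn.and 1
  args
    | .inl q => fun a => D.chainWire ((D.argEquiv q a).1).1 ((D.argEquiv q a).1).2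
    | .inr c => fun _ => D.chainWire c.1 (c.2.1 - 1)
  out := D.embed (D.qcore D.out)
  wf := by
    refine Subrelation.wf ?_ (InvImage.wf D.rrank wellFounded_lt)
    rintro g' g ⟨a, ha⟩
    show D.rrank g' < D.rrank g
    have hB : ∀ w, D.mult w < D.multBound := D.mult_lt_multBound
    -- the rank of the target of `chainWire w k` with `k < mult w ∨ k = 0`
    have key : ∀ (w : ι ⊕ D.CQ) (k : ℕ) (g' : D.RGate), D.chainWire w k = Sum.inr g' →
        D.rrank g' ≤ D.multBound * D.wrank w + k ∧ (k = 0 → ∃ q', w = Sum.inr q' ∧ g' = Sum.inl q') := by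
      intro w k g' h
      by_cases hk : 1 ≤ k ∧ k < D.mult w
      · rw [D.chainWire_of_lt hk.1 hk.2, Sum.inr.injEq] at h
        subst h
        exact ⟨le_rfl, fun h0 => by omega⟩
      · unfold chainWire at h
        rw [dif_neg hk] at h
        rcases w with i | q'
        · exact absurd h Sum.inl_ne_inr
        · simp only [embed, Sum.map_inr, Sum.inr.injEq] at h
          subst h
          refine ⟨?_, fun _ => ⟨q', rfl, rfl⟩⟩
          show D.multBound * (D.chQ q' + 1) ≤ D.multBound * (D.chQ q' + 1) + k
          omega
    rcases g with q | ⟨w, k, hk⟩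
    · -- a class gate reads copies of wires of its child multiset
      change D.chainWire ((D.argEquiv q a).1).1 ((D.argEquiv q a).1).2 = Sum.inr g' at ha
      have hp := (D.argEquiv q a).2
      rw [mem_pairsFS] at hp
      obtain ⟨h1, -⟩ := key _ _ _ ha
      refine lt_of_le_of_lt h1 ?_
      show D.multBound * D.wrank ((D.argEquiv q a).1).1 + ((D.argEquiv q a).1).2 < D.multBound * (D.chQ q + 1)
      have hlt : ((D.argEquiv q a).1).2 < D.multBound :=
        lt_trans (lt_of_lt_of_le hp (D.count_le_mult _ _)) (hB _)
      have hw : D.wrank ((D.argEquiv q a).1).1 ≤ D.chQ q := by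
        rcases hw' : ((D.argEquiv q a).1).1 with i | q'
        · exact Nat.zero_le _
        · show D.chQ q' + 1 ≤ D.chQ q
          apply D.chQ_lt_of_mem_cmQ
          rw [← Multiset.count_pos, ← hw']; omega
      calc D.multBound * D.wrank ((D.argEquiv q a).1).1 + ((D.argEquiv q a).1).2
          < D.multBound * D.wrank ((D.argEquiv q a).1).1 + D.multBound := by omega
        _ = D.multBound * (D.wrank ((D.argEquiv q a).1).1 + 1) := by ring
        _ ≤ D.multBound * (D.chQ q + 1) := Nat.mul_le_mul_left _ (by omega)
    · -- a chain gate reads the previous copy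
      change D.chainWire w (k.1 - 1) = Sum.inr g' at ha
      obtain ⟨h1, h2⟩ := key _ _ _ ha
      show D.rrank g' < D.multBound * D.wrank w + k.1
      rcases Nat.lt_or_ge 1 k.1 with hk1 | hk1
      · omega
      · have hk0 : k.1 - 1 = 0 := by omega
        obtain ⟨q', rfl, rfl⟩ := h2 hk0
        show D.multBound * (D.chQ q' + 1) < D.multBound * (D.chQ q' + 1) + k.1
        omega

/-! ### The reduced circuit computes the same values -/

/-- The gate function of a class gate of the reduced circuit. [folklore] -/
@[simp] theorem reduce_fn_inl (q : D.CQ) : D.reduce.fn (Sum.inl q) = D.fnQ q := rfl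

/-- The gate function of a chain gate is `∧₁`. [folklore] -/
@[simp] theorem reduce_fn_inr (c : D.ChainIdx) : D.reduce.fn (Sum.inr c) = GateFn.and 1 := rfl

/-- The wires of a class gate. [folklore] -/
theorem reduce_args_inl (q : D.CQ) (a : Fin (D.fnQ q).1) :
    D.reduce.args (Sum.inl q) a = D.chainWire ((D.argEquiv q a).1).1 ((D.argEquiv q a).1).2 := rfl

/-- The wire of a chain gate. [folklore] -/
theorem reduce_args_inr (c : D.ChainIdx) (a : Fin 1) :
    D.reduce.args (Sum.inr c) a = D.chainWire c.1 (c.2.1 - 1) := rfl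

/-- The output of the reduced circuit. [folklore] -/
theorem reduce_out : D.reduce.out = D.embed (D.qcore D.out) := rfl

/-- The intended values of class wires: inputs read the input, a class the (common) value of its
members. [folklore] -/
def qval (x : ι → Bool) : ι ⊕ D.CQ → Bool := Sum.elim x fun q => D.val x q.out.1

omit [Fintype Λ] in
/-- The class wire of the core of `w` has the value of `w`. [folklore] -/
theorem qval_qcore (hsym : ∀ l, (D.fn l).IsSymmetric) (x : ι → Bool) (w : ι ⊕ Λ) :
    D.qval x (D.qcore w) = wire x (D.val x) w := by
  rw [← D.wire_core x w, ← D.map_val_coreN w]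
  unfold qcore qw
  rcases D.coreN w with i | m
  · rfl
  · exact Cong.val_eq D hsym x (D.cong_out m)

/-- A pair drawn from `pairsFS (cmQ q)` is in the range of `chainWire`. [folklore] -/
theorem argEquiv_snd_lt (q : D.CQ) (a : Fin (D.fnQ q).1) :
    ((D.argEquiv q a).1).2 < D.mult ((D.argEquiv q a).1).1 := by
  have hp := (D.argEquiv q a).2
  rw [mem_pairsFS] at hp
  exact lt_of_lt_of_le hp (D.count_le_mult _ _)

/-- **The reduced circuit computes, at a class, the value of its members, and at a chain gate the
value of the underlying wire.** [cite: AndersonDawar2016, Lemma 7] -/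
theorem val_reduce (hsym : ∀ l, (D.fn l).IsSymmetric) (x : ι → Bool) (g : D.RGate) :
    D.reduce.val x g = Sum.elim (fun q => D.val x q.out.1) (fun c => D.qval x c.1) g := by
  induction g using D.reduce.wf.induction with
  | _ g ih =>
    -- the value of a copy of a wire read by `g`
    have hcw : ∀ (w : ι ⊕ D.CQ) (k : ℕ), (∃ a, D.reduce.args g a = D.chainWire w k) →
        wire x (D.reduce.val x) (D.chainWire w k) = D.qval x w := by
      rintro w k ⟨a, ha⟩
      by_cases hk : 1 ≤ k ∧ k < D.mult w
      · rw [D.chainWire_of_lt hk.1 hk.2] at ha ⊢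
        rw [wire_inr, ih _ ⟨a, ha⟩]
        rfl
      · unfold chainWire at ha ⊢
        rw [dif_neg hk] at ha ⊢
        rcases w with i | q
        · rfl
        · change D.reduce.args g a = Sum.inr (Sum.inl q) at ha
          show D.reduce.val x (Sum.inl q) = _
          rw [ih _ ⟨a, ha⟩]
          rfl
    rcases g with q | ⟨w, k, hk⟩
    · -- class gate
      rw [D.reduce.val_eq]
      show (D.fn q.out.1).2 (fun a => wire x (D.reduce.val x) (D.reduce.args (Sum.inl q) a)) = D.val x q.out.1
      have h1 : (fun a : Fin (D.fn q.out.1).1 => wire x (D.reduce.val x) (D.reduce.args (Sum.inl q) a)) =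
          fun a => D.qval x ((D.argEquiv q a).1).1 := by
        funext a
        exact hcw _ _ ⟨a, rfl⟩
      rw [h1, D.val_eq]
      have h2 : (fun b => wire x (D.val x) (D.args q.out.1 b)) = fun b => D.qval x (D.qcore (D.args q.out.1 b)) := by
        funext b; rw [D.qval_qcore hsym]
      rw [h2]
      -- the two argument families have the same multiset of class wires
      have hms : (univ : Finset (Fin (D.fnQ q).1)).val.map (fun a => ((D.argEquiv q a).1).1) =
          (univ : Finset (Fin (D.fn q.out.1).1)).val.map (fun b => D.qcore (D.args q.out.1 b)) := by
        change _ = D.cm q.out.1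
        have : (fun a => ((D.argEquiv q a).1).1) = Prod.fst ∘ Subtype.val ∘ (D.argEquiv q) := rfl
        rw [this, ← Multiset.map_map, ← Multiset.map_map, Multiset.map_univ_val_equiv,
          univ_val_map_coe_finset]
        exact D.map_fst_pairsFS _
      obtain ⟨e, he⟩ := exists_equiv_of_map_univ_val_eq _ _ hms
      symm
      refine (hsym q.out.1) _ _ ?_
      have hfun : (fun a => D.qval x ((D.argEquiv q a).1).1) =
          fun a => (fun b => D.qval x (D.qcore (D.args q.out.1 b))) (e a) := by
        funext a; beta_reduce; rw [he a]
      rw [hfun]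
      symm
      exact Circuit.numOnes_eq_of_perm_map (a := ⇑e) (a' := _root_.id) (F := _root_.id)
        (u := fun b => D.qval x (D.qcore (D.args q.out.1 b)))
        (u' := fun b => D.qval x (D.qcore (D.args q.out.1 b)))
        (by rw [List.map_id]; exact ofFn_perm_of_equiv e fun a => rfl) (fun i => rfl)
    · -- chain gate
      rw [D.reduce.val_eq]
      show (GateFn.and 1).2 (fun a => wire x (D.reduce.val x) (D.reduce.args (Sum.inr ⟨w, k, hk⟩) a)) =
        D.qval x w
      rw [GateFn.and_one_apply rfl]
      exact hcw w (k.1 - 1) ⟨⟨0, Nat.one_pos⟩, rfl⟩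

/-- The class gate of the reduced circuit computes the value of the members of the class.
[cite: AndersonDawar2016, Lemma 7] -/
theorem val_reduce_cls (hsym : ∀ l, (D.fn l).IsSymmetric) (x : ι → Bool) (l : D.NI) :
    D.reduce.val x (Sum.inl (D.cls l)) = D.val x l.1 := by
  rw [D.val_reduce hsym]
  exact Cong.val_eq D hsym x (D.cong_out l)

/-- The value of an embedded class wire. [folklore] -/
theorem wire_embed (hsym : ∀ l, (D.fn l).IsSymmetric) (x : ι → Bool) (w : ι ⊕ D.CQ) :
    wire x (D.reduce.val x) (D.embed w) = D.qval x w := by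
  rcases w with i | q
  · rfl
  · show D.reduce.val x (Sum.inl q) = _
    rw [D.val_reduce hsym]; rfl

/-- **The reduced circuit computes the same function.** [cite: AndersonDawar2016, Lemma 7] -/
theorem evalOut_reduce (hsym : ∀ l, (D.fn l).IsSymmetric) (x : ι → Bool) :
    D.reduce.evalOut x = D.evalOut x := by
  rw [evalOut, reduce_out, D.wire_embed hsym, D.qval_qcore hsym]; rfl

/-- The reduced circuit is over any basis containing the gate functions of `D` and `∧₁`.
[cite: AndersonDawar2016, Lemma 7] -/
theorem reduce_fn_mem {B : Set GateFn} (hB : ∀ l, D.fn l ∈ B) (hand : GateFn.and 1 ∈ B) :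
    ∀ g, D.reduce.fn g ∈ B
  | .inl _ => hB _
  | .inr _ => hand

/-- **The reduced circuit is simply wired**: every gate reads pairwise distinct wires (this is
what the chains are for). [cite: AndersonDawar2016, Lemma 7 (proof: the ∧-chains)] -/
theorem reduce_args_injective : ∀ g, Function.Injective (D.reduce.args g)
  | .inl q => by
    intro a b hab
    rw [reduce_args_inl, reduce_args_inl] at hab
    have h := D.chainWire_inj (Or.inl (D.argEquiv_snd_lt q a)) (Or.inl (D.argEquiv_snd_lt q b)) hab
    apply (D.argEquiv q).injective
    apply Subtype.ext
    exact Prod.ext h.1 h.2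
  | .inr c => fun a b _ => Subsingleton.elim (α := Fin 1) a b

/-! ### The reduced circuit is reduced (hence rigid) -/

/-- Finsets with the same image multiset under a map injective on their union are equal.
[folklore] -/
theorem finset_eq_of_map_val_eq {α β : Type*} {A B : Finset α} {f : α → β}
    (hinj : ∀ a ∈ A, ∀ b ∈ B, f a = f b → a = b) (h : A.val.map f = B.val.map f) : A = B := by
  ext p
  constructor
  · intro hp
    have : f p ∈ B.val.map f := by rw [← h]; exact Multiset.mem_map_of_mem f hp
    obtain ⟨b, hb, hfb⟩ := Multiset.mem_map.1 this
    rwa [hinj p hp b hb hfb.symm]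
  · intro hp
    have : f p ∈ A.val.map f := by rw [h]; exact Multiset.mem_map_of_mem f hp
    obtain ⟨a, ha, hfa⟩ := Multiset.mem_map.1 this
    rwa [← hinj a ha p hp hfa]

/-- The argument multiset of a class gate is the image of the pairs of its child multiset.
[folklore] -/
theorem coe_ofFn_args_reduce_inl (q : D.CQ) :
    ((List.ofFn (D.reduce.args (Sum.inl q)) : List (ι ⊕ D.RGate)) : Multiset (ι ⊕ D.RGate)) =
      (D.pairsFS (D.cmQ q)).val.map (fun p => D.chainWire p.1 p.2) := by
  rw [← univ_val_map_coe_finset (D.pairsFS (D.cmQ q)), Multiset.map_map,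
    ← Multiset.map_univ_val_equiv (D.argEquiv q), Multiset.map_map, ← Fin.univ_val_map]
  rfl

/-- A list over `Fin 1` is a singleton. [folklore] -/
theorem ofFn_fin_one {α : Type*} (f : Fin 1 → α) : List.ofFn f = [f 0] := by
  rw [List.ofFn_succ]; rfl

/-- **The reduced circuit is reduced.** [cite: AndersonDawar2016, Lemma 7 and Def. 8] -/
theorem reduced_reduce : D.reduce.Reduced := by
  rintro (q | ⟨w, k, hk⟩) (q' | ⟨w', k', hk'⟩) hfn hperm
  · -- two classes with the same gate function and the same argument multiset are equal
    have hms := Multiset.coe_eq_coe.2 hperm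
    rw [coe_ofFn_args_reduce_inl, coe_ofFn_args_reduce_inl] at hms
    have hpairs : D.pairsFS (D.cmQ q) = D.pairsFS (D.cmQ q') := by
      refine finset_eq_of_map_val_eq (fun a ha b hb hab => ?_) hms
      rw [mem_pairsFS] at ha hb
      have h := D.chainWire_inj (Or.inl (lt_of_lt_of_le ha (D.count_le_mult _ _)))
        (Or.inl (lt_of_lt_of_le hb (D.count_le_mult _ _))) hab
      exact Prod.ext h.1 h.2
    have hcm : D.cmQ q = D.cmQ q' := D.pairsFS_injective hpairs
    have hcong : D.Cong q.out.1 q'.out.1 := (D.cong_iff_cm _ _).2 ⟨hfn, hcm⟩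
    rw [Sum.inl.injEq, ← Quotient.out_eq q, ← Quotient.out_eq q']
    exact Quotient.sound hcong
  · exact absurd hfn (D.fnQ_ne q)
  · exact absurd hfn.symm (D.fnQ_ne q')
  · -- two chain gates reading the same copy are equal
    change (List.ofFn fun _ : Fin 1 => D.chainWire w (k.1 - 1)).Perm
      (List.ofFn fun _ : Fin 1 => D.chainWire w' (k'.1 - 1)) at hperm
    rw [ofFn_fin_one, ofFn_fin_one, List.singleton_perm_singleton] at hperm
    have h := D.chainWire_inj (Or.inl (by omega : k.1 - 1 < D.mult w)) (Or.inl (by omega : k'.1 - 1 < D.mult w')) hperm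
    obtain ⟨rfl, h2⟩ := h
    have hkk : k = k' := Fin.ext (by omega)
    subst hkk
    rfl

/-- **The reduced circuit is rigid.** [cite: AndersonDawar2016, Lemma 7 with Prop. 9] -/
theorem isRigidDAG_reduce : D.reduce.IsRigidDAG := D.reduced_reduce.isRigidDAG

/-! ### Automorphisms descend to the reduced circuit -/

omit [Fintype Λ] in
/-- The argument list of an identity gate is the singleton of its argument. [folklore] -/
theorem ofFn_args_of_isIdGate {l : Λ} (h : D.IsIdGate l) : List.ofFn (D.args l) = [D.args l (D.idIdx h)] := by
  have hlen : (List.ofFn (D.args l)).length = 1 := by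
    rw [List.length_ofFn]; exact congrArg Sigma.fst h
  obtain ⟨w, hw⟩ := List.length_eq_one_iff.1 hlen
  rw [hw, List.cons.injEq]
  refine ⟨?_, rfl⟩
  have h0 : 0 < (List.ofFn (D.args l)).length := by rw [hlen]; exact Nat.one_pos
  have := List.getElem_ofFn (f := D.args l) h0
  simp only [hw, List.getElem_cons_zero] at this
  rw [this]
  congr 1

namespace IsAut

variable {D}
variable {π : Equiv.Perm ι} {θ : Λ ≃ Λ} (h : D.IsAut π θ)
include h

omit [Fintype Λ] in
/-- Automorphisms preserve identity gates. [folklore] -/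
theorem isIdGate_iff (l : Λ) : D.IsIdGate (θ l) ↔ D.IsIdGate l := by
  unfold IsIdGate; rw [h.fn_eq]

omit [Fintype Λ] in
/-- The argument of the image of an identity gate. [folklore] -/
theorem args_idIdx {l : Λ} (hid : D.IsIdGate l) :
    D.args (θ l) (D.idIdx ((h.isIdGate_iff l).2 hid)) = Sum.map π θ (D.args l (D.idIdx hid)) := by
  have hp := h.args_perm l
  rw [D.ofFn_args_of_isIdGate ((h.isIdGate_iff l).2 hid), D.ofFn_args_of_isIdGate hid,
    List.map_singleton, List.singleton_perm_singleton] at hp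
  exact hp

omit [Fintype Λ] in
/-- **Automorphisms commute with taking cores.** [folklore] -/
theorem core_map (w : ι ⊕ Λ) : D.core (Sum.map π θ w) = Sum.map π θ (D.core w) := by
  rcases w with i | l
  · rfl
  · simp only [Sum.map_inr, core_inr]
    induction l using D.wf.induction with
    | _ l ih =>
      by_cases hid : D.IsIdGate l
      · have hid' : D.IsIdGate (θ l) := (h.isIdGate_iff l).2 hid
        rw [D.coreGate_of_isIdGate hid', D.coreGate_of_isIdGate hid, h.args_idIdx hid]
        cases hw : D.args l (D.idIdx hid) with
        | inl i => rfl
        | inr m => simp only [Sum.map_inr, core_inr]; exact ih m ⟨_, hw⟩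
      · rw [D.coreGate_of_not_isIdGate hid, D.coreGate_of_not_isIdGate ((h.isIdGate_iff l).not.2 hid)]
        rfl

omit [Fintype Λ] in
/-- The automorphism on non-identity gates. [folklore] -/
def θN : D.NI ≃ D.NI := θ.subtypeEquiv fun l => (h.isIdGate_iff l).not.symm

omit [Fintype Λ] in
/-- `θN` is `θ` on the underlying gate. [folklore] -/
@[simp] theorem θN_val (l : D.NI) : (h.θN l).1 = θ l.1 := rfl

omit [Fintype Λ] in
/-- Automorphisms commute with `coreN`. [folklore] -/
theorem coreN_map (w : ι ⊕ Λ) : D.coreN (Sum.map π θ w) = Sum.map π h.θN (D.coreN w) := by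
  have hinj : Function.Injective (Sum.map (_root_.id : ι → ι) (Subtype.val : D.NI → Λ)) :=
    Sum.map_injective.2 ⟨Function.injective_id, Subtype.val_injective⟩
  apply hinj
  rw [map_val_coreN, h.core_map, ← D.map_val_coreN w]
  rcases D.coreN w with i | m <;> rfl

omit [Fintype Λ] h in
/-- `WRel` is compatible with relabelling. [folklore] -/
theorem wrel_map {R : Λ → Λ → Prop} (hR : ∀ m m', R m m' → R (θ m) (θ m')) :
    ∀ {w w' : ι ⊕ Λ}, WRel R w w' → WRel R (Sum.map π θ w) (Sum.map π θ w')
  | .inl _, .inl _, hw => congrArg π hw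
  | .inr _, .inr _, hw => hR _ _ hw
  | .inl _, .inr _, hw => hw.elim
  | .inr _, .inl _, hw => hw.elim

omit [Fintype Λ] in
/-- **Automorphisms preserve congruence** (depth by depth). [cite: AndersonDawar2016, Lemma 7 (proof)] -/
theorem congH_map {k : ℕ} : ∀ {l l' : Λ}, D.CongH k l l' → D.CongH k (θ l) (θ l') := by
  induction k with
  | zero => intro l l' hc; exact hc.elim
  | succ k ih =>
    rintro l l' ⟨hfn, e, he⟩
    refine ⟨by rw [h.fn_eq, h.fn_eq, hfn], ?_⟩
    -- bijections of positions realising the permutations of argument lists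
    have hu := h.args_perm l
    rw [List.map_ofFn] at hu
    obtain ⟨u, hu⟩ := exists_equiv_of_ofFn_perm hu
    have hu' := h.args_perm l'
    rw [List.map_ofFn] at hu'
    obtain ⟨u', hu'⟩ := exists_equiv_of_ofFn_perm hu'
    refine ⟨u.trans (e.trans u'.symm), fun a => ?_⟩
    rw [← hu a, Equiv.trans_apply, Equiv.trans_apply, ← hu' (u'.symm (e (u a))), Equiv.apply_symm_apply]
    simp only [Function.comp_apply]
    rw [h.core_map, h.core_map]
    exact wrel_map (fun m m' hm => ih hm) (he (u a))

omit [Fintype Λ] in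
/-- Automorphisms preserve congruence. [cite: AndersonDawar2016, Lemma 7 (proof)] -/
theorem cong_map {l l' : Λ} (hc : D.Cong l l') : D.Cong (θ l) (θ l') := by
  obtain ⟨k, hk⟩ := hc; exact ⟨k, h.congH_map hk⟩

omit [Fintype Λ] in
/-- Automorphisms preserve and reflect congruence. [cite: AndersonDawar2016, Lemma 7 (proof)] -/
theorem cong_map_iff (l l' : Λ) : D.Cong (θ l) (θ l') ↔ D.Cong l l' := by
  refine ⟨fun hc => ?_, h.cong_map⟩
  have := (h.symm D).cong_map hc
  simpa using this

omit [Fintype Λ] in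
/-- **The automorphism on congruence classes.** [cite: AndersonDawar2016, Lemma 7 (proof)] -/
def θQ : D.CQ ≃ D.CQ :=
  Quotient.congr h.θN fun a b => (h.cong_map_iff a.1 b.1).symm

omit [Fintype Λ] in
/-- `θQ` on the class of `l` is the class of `θ l`. [folklore] -/
@[simp] theorem θQ_cls (l : D.NI) : h.θQ (D.cls l) = D.cls (h.θN l) := rfl

omit [Fintype Λ] in
/-- The induced map on class wires. [folklore] -/
def mapW : (ι ⊕ D.CQ) ≃ (ι ⊕ D.CQ) := Equiv.sumCongr π h.θQ

omit [Fintype Λ] in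
/-- `mapW` as a function. [folklore] -/
theorem mapW_eq : ⇑h.mapW = Sum.map π h.θQ := rfl

omit [Fintype Λ] in
/-- Automorphisms commute with `qcore`. [folklore] -/
theorem qcore_map (w : ι ⊕ Λ) : D.qcore (Sum.map π θ w) = h.mapW (D.qcore w) := by
  unfold qcore
  rw [h.coreN_map, mapW_eq]
  rcases D.coreN w with i | m <;> rfl

omit [Fintype Λ] in
/-- **Automorphisms act on child multisets.** [cite: AndersonDawar2016, Lemma 7 (proof)] -/
theorem cm_map (l : Λ) : D.cm (θ l) = (D.cm l).map h.mapW := by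
  have hu := h.args_perm l
  rw [List.map_ofFn] at hu
  obtain ⟨u, hu⟩ := exists_equiv_of_ofFn_perm hu
  unfold cm
  have hfun : (fun a => D.qcore (D.args (θ l) a)) = (h.mapW ∘ fun b => D.qcore (D.args l b)) ∘ u := by
    funext a
    simp only [Function.comp_apply]
    rw [← hu a, Function.comp_apply, h.qcore_map]
  rw [hfun, ← Multiset.map_map, Multiset.map_univ_val_equiv, Multiset.map_map]

omit [Fintype Λ] in
/-- The gate function of a class is invariant. [folklore] -/
theorem fnQ_map (q : D.CQ) : D.fnQ (h.θQ q) = D.fnQ q := by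
  conv_lhs => rw [← Quotient.out_eq q]
  rw [θQ_cls, fnQ_cls, fnQ, θN_val, h.fn_eq]

omit [Fintype Λ] in
/-- The child multiset of the image class. [folklore] -/
theorem cmQ_map (q : D.CQ) : D.cmQ (h.θQ q) = (D.cmQ q).map h.mapW := by
  conv_lhs => rw [← Quotient.out_eq q]
  rw [θQ_cls, cmQ_cls, θN_val, h.cm_map]; rfl

/-- **Multiplicities are invariant.** [folklore] -/
theorem mult_map (w : ι ⊕ D.CQ) : D.mult (h.mapW w) = D.mult w := by
  unfold mult
  have : (fun q : D.CQ => (D.cmQ q).count (h.mapW w)) ∘ h.θQ = fun q => (D.cmQ q).count w := by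
    funext q
    simp only [Function.comp_apply]
    rw [h.cmQ_map, Multiset.count_map_eq_count' _ _ h.mapW.injective]
  rw [← this, sup_univ_comp_equiv]

/-- The automorphism on chain gates: `⟨w, k⟩ ↦ ⟨mapW w, k⟩`. [folklore] -/
def θCH : D.ChainIdx ≃ D.ChainIdx :=
  Equiv.sigmaCongr h.mapW fun w =>
    (finCongr (h.mult_map w).symm).subtypeEquiv fun _ => Iff.rfl

/-- `θCH` explicitly. [folklore] -/
theorem θCH_apply (w : ι ⊕ D.CQ) (k : Fin (D.mult w)) (hk : 1 ≤ (k : ℕ)) :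
    h.θCH ⟨w, k, hk⟩ = ⟨h.mapW w, ⟨(k : ℕ), by rw [h.mult_map]; exact k.2⟩, hk⟩ := rfl

/-- **The automorphism of the reduced circuit** induced by an automorphism of `D`.
[cite: AndersonDawar2016, Lemma 7 (proof)] -/
def θR : D.RGate ≃ D.RGate := Equiv.sumCongr h.θQ h.θCH

/-- `θR` on a class gate. [folklore] -/
@[simp] theorem θR_inl (q : D.CQ) : h.θR (Sum.inl q) = Sum.inl (h.θQ q) := rfl

/-- `θR` on a chain gate. [folklore] -/
@[simp] theorem θR_inr (c : D.ChainIdx) : h.θR (Sum.inr c) = Sum.inr (h.θCH c) := rfl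

/-- Relabelling an embedded class wire. [folklore] -/
theorem map_embed (w : ι ⊕ D.CQ) : Sum.map π h.θR (D.embed w) = D.embed (h.mapW w) := by
  rcases w with i | q <;> rfl

/-- **Relabelling a copy of a wire gives the same copy of the relabelled wire.** [folklore] -/
theorem map_chainWire (w : ι ⊕ D.CQ) (k : ℕ) :
    Sum.map π h.θR (D.chainWire w k) = D.chainWire (h.mapW w) k := by
  by_cases hk : 1 ≤ k ∧ k < D.mult w
  · rw [D.chainWire_of_lt hk.1 hk.2, D.chainWire_of_lt hk.1 (by rw [h.mult_map]; exact hk.2)]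
    rfl
  · unfold chainWire
    rw [dif_neg hk, dif_neg (by rw [h.mult_map]; exact hk), h.map_embed]

omit [Fintype Λ] in
/-- `pairsFS` commutes with an injective relabelling of wires. [folklore] -/
theorem pairsFS_map (s : Multiset (ι ⊕ D.CQ)) :
    D.pairsFS (s.map h.mapW) = (D.pairsFS s).map ⟨fun p => (h.mapW p.1, p.2),
      fun p p' hp => by
        simp only [Prod.mk.injEq] at hp
        exact Prod.ext (h.mapW.injective hp.1) hp.2⟩ := by
  ext ⟨w', k⟩
  rw [mem_pairsFS, Finset.mem_map]
  constructor
  · intro hk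
    have hpos : 0 < (s.map h.mapW).count w' := by simp only at hk; omega
    rw [Multiset.count_pos, Multiset.mem_map] at hpos
    obtain ⟨w, -, rfl⟩ := hpos
    refine ⟨(w, k), ?_, rfl⟩
    rw [mem_pairsFS]
    simpa [Multiset.count_map_eq_count' _ _ h.mapW.injective] using hk
  · rintro ⟨⟨w, k'⟩, hp, hp'⟩
    simp only [Function.Embedding.coeFn_mk, Prod.mk.injEq] at hp'
    obtain ⟨rfl, rfl⟩ := hp'
    rw [mem_pairsFS] at hp
    simpa [Multiset.count_map_eq_count' _ _ h.mapW.injective] using hp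

/-- **An automorphism of `D` over `π` induces an automorphism of the reduced circuit over `π`.**
[cite: AndersonDawar2016, Lemma 7 (proof)] -/
theorem reduce : D.reduce.IsAut π h.θR := by
  refine ⟨?_, ?_, ?_⟩
  · rw [reduce_out, h.map_embed, ← h.qcore_map, h.out_eq]
  · rintro (q | c)
    · exact h.fnQ_map q
    · rfl
  · rintro (q | ⟨w, k, hk⟩)
    · -- class gate: compare the argument multisets
      rw [θR_inl, ← Multiset.coe_eq_coe, ← Multiset.map_coe, coe_ofFn_args_reduce_inl,
        coe_ofFn_args_reduce_inl, h.cmQ_map, h.pairsFS_map, Finset.map_val,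
        Multiset.map_map, Multiset.map_map]
      congr 1
      funext p
      simp only [Function.comp_apply, Function.Embedding.coeFn_mk]
      exact (h.map_chainWire p.1 p.2).symm
    · rw [θR_inr, θCH_apply]
      change (List.ofFn fun _ : Fin 1 => D.chainWire (h.mapW w) (k.1 - 1)).Perm
        ((List.ofFn fun _ : Fin 1 => D.chainWire w (k.1 - 1)).map (Sum.map π h.θR))
      rw [ofFn_fin_one, ofFn_fin_one, List.map_singleton, h.map_chainWire]

end IsAut

/-! ### Orbits of the reduced circuit -/

section Orbits

variable {D}
variable (A : Set (Equiv.Perm ι × (Λ ≃ Λ))) (hA : ∀ a ∈ A, D.IsAut (⇑a.1) a.2)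
include hA

/-- The orbit of a gate of `D` TRACED by a chosen family `A` of automorphisms. [folklore] -/
def traced (A : Set (Equiv.Perm ι × (Λ ≃ Λ))) (l : Λ) : Set Λ := {l' | ∃ a ∈ A, a.2 l = l'}

omit [Fintype Λ] hA in
/-- The traced orbit is contained in the orbit. [folklore] -/
theorem traced_subset_orbit {P : Set (ι → ι)} (hAP : ∀ a ∈ A, D.IsAut (⇑a.1) a.2 ∧ (⇑a.1 : ι → ι) ∈ P) (l : Λ) :
    traced A l ⊆ D.orbit P l := by
  rintro l' ⟨a, ha, rfl⟩
  exact ⟨_, (hAP a ha).2, a.2, (hAP a ha).1, rfl⟩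

/-- **Orbits of the reduced circuit are traced by any covering family of automorphisms of `D`.**
In the (reduced, hence rigid) reduced circuit all automorphisms over a given input map agree, so
the orbit of a gate under the input maps `P` is the set of its images under the automorphisms
induced (`IsAut.θR`) by ANY family `A` of automorphisms of `D` covering `P`.
[cite: AndersonDawar2016, Lemma 7 with Prop. 9] -/
theorem orbit_reduce_subset {P : Set (ι → ι)} (hcov : ∀ π ∈ P, ∃ a ∈ A, (⇑a.1 : ι → ι) = π) (g : D.RGate) :
    D.reduce.orbit P g ⊆ {g' | ∃ a, ∃ ha : a ∈ A, (hA a ha).θR g = g'} := by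
  refine (D.reduce.orbit_subset_of_witness D.reduced_reduce
    (fun π θ' => ∃ a, ∃ ha : a ∈ A, (⇑a.1 : ι → ι) = π ∧ θ' = (hA a ha).θR) (fun π hπ => ?_) g).trans ?_
  · obtain ⟨a, ha, rfl⟩ := hcov π hπ
    exact ⟨_, ⟨a, ha, rfl, rfl⟩, (hA a ha).reduce⟩
  · rintro g' ⟨π, -, θ', ⟨a, ha, -, rfl⟩, rfl⟩
    exact ⟨a, ha, rfl⟩

/-- The orbit of a class gate is bounded by the traced orbit of a member. [cite: AndersonDawar2016, Lemma 7] -/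
theorem ncard_orbit_reduce_inl_le {P : Set (ι → ι)} (hcov : ∀ π ∈ P, ∃ a ∈ A, (⇑a.1 : ι → ι) = π)
    (l : D.NI) : (D.reduce.orbit P (Sum.inl (D.cls l))).ncard ≤ (traced A l.1).ncard := by
  let repr : Λ → D.RGate := fun l' => if hl' : ¬ D.IsIdGate l' then Sum.inl (D.cls ⟨l', hl'⟩) else Sum.inl (D.cls l)
  refine le_trans (Set.ncard_le_ncard ?_ ((Set.toFinite _).image repr)) (Set.ncard_image_le (Set.toFinite _))
  refine (orbit_reduce_subset A hA hcov _).trans ?_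
  rintro g' ⟨a, ha, rfl⟩
  refine ⟨a.2 l.1, ⟨a, ha, rfl⟩, ?_⟩
  have hnid : ¬ D.IsIdGate (a.2 l.1) := ((hA a ha).isIdGate_iff l.1).not.2 l.2
  simp only [repr, dif_pos hnid, IsAut.θR_inl, IsAut.θQ_cls]
  rfl

/-- The orbit of a chain gate over a class is bounded by the traced orbit of a member.
[cite: AndersonDawar2016, Lemma 7] -/
theorem ncard_orbit_reduce_chain_cls_le {P : Set (ι → ι)} (hcov : ∀ π ∈ P, ∃ a ∈ A, (⇑a.1 : ι → ι) = π)
    (l : D.NI) (k : Fin (D.mult (Sum.inr (D.cls l)))) (hk : 1 ≤ (k : ℕ)) :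
    (D.reduce.orbit P (Sum.inr ⟨Sum.inr (D.cls l), k, hk⟩)).ncard ≤ (traced A l.1).ncard := by
  let g : D.RGate := Sum.inr ⟨Sum.inr (D.cls l), k, hk⟩
  let repr : Λ → D.RGate := fun l' =>
    if h1 : ¬ D.IsIdGate l' then
      (if h2 : (k : ℕ) < D.mult (Sum.inr (D.cls ⟨l', h1⟩)) then Sum.inr ⟨Sum.inr (D.cls ⟨l', h1⟩), ⟨k, h2⟩, hk⟩
        else g)
    else g
  refine le_trans (Set.ncard_le_ncard ?_ ((Set.toFinite _).image repr)) (Set.ncard_image_le (Set.toFinite _))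
  refine (orbit_reduce_subset A hA hcov _).trans ?_
  rintro g' ⟨a, ha, rfl⟩
  refine ⟨a.2 l.1, ⟨a, ha, rfl⟩, ?_⟩
  have h1 : ¬ D.IsIdGate (a.2 l.1) := ((hA a ha).isIdGate_iff l.1).not.2 l.2
  have h2 : (k : ℕ) < D.mult (Sum.inr (D.cls ⟨a.2 l.1, h1⟩)) := by
    have := (hA a ha).mult_map (Sum.inr (D.cls l))
    rw [IsAut.mapW_eq, Sum.map_inr, IsAut.θQ_cls] at this
    rw [show (⟨a.2 l.1, h1⟩ : D.NI) = (hA a ha).θN l from rfl, this]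
    exact k.2
  simp only [repr, dif_pos h1, dif_pos h2, IsAut.θR_inr, IsAut.θCH_apply]
  rfl

omit [Fintype Λ] hA in
/-- A range has at most as many elements as the domain. [folklore] -/
theorem ncard_range_le_card [Fintype ι] {β : Type*} (f : ι → β) : (Set.range f).ncard ≤ Fintype.card ι := by
  rw [← Set.image_univ, ← Nat.card_eq_fintype_card, ← Set.ncard_univ]
  exact Set.ncard_image_le (Set.toFinite _)

/-- The orbit of a chain gate over an input is bounded by the number of inputs.
[cite: AndersonDawar2016, Lemma 7] -/
theorem ncard_orbit_reduce_chain_inl_le [Fintype ι] {P : Set (ι → ι)}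
    (hcov : ∀ π ∈ P, ∃ a ∈ A, (⇑a.1 : ι → ι) = π)
    (i : ι) (k : Fin (D.mult (Sum.inl i))) (hk : 1 ≤ (k : ℕ)) :
    (D.reduce.orbit P (Sum.inr ⟨Sum.inl i, k, hk⟩)).ncard ≤ Fintype.card ι := by
  let g : D.RGate := Sum.inr ⟨Sum.inl i, k, hk⟩
  let repr : ι → D.RGate := fun i' =>
    if h2 : (k : ℕ) < D.mult (Sum.inl i') then Sum.inr ⟨Sum.inl i', ⟨k, h2⟩, hk⟩ else g
  refine le_trans (Set.ncard_le_ncard ?_ (Set.toFinite _)) (ncard_range_le_card repr)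
  refine (orbit_reduce_subset A hA hcov _).trans ?_
  rintro g' ⟨a, ha, rfl⟩
  refine ⟨a.1 i, ?_⟩
  have h2 : (k : ℕ) < D.mult (Sum.inl (a.1 i)) := by
    have := (hA a ha).mult_map (Sum.inl i)
    rw [IsAut.mapW_eq, Sum.map_inl] at this
    rw [this]
    exact k.2
  simp only [repr, dif_pos h2, IsAut.θR_inr, IsAut.θCH_apply]
  rfl

/-- **Uniform orbit bound for the reduced circuit**: if every traced orbit of `D` has at most
`s` gates, every orbit of the reduced circuit has at most `max s |ι|` gates.
[cite: AndersonDawar2016, Lemma 7 ("the conversion does not increase orbit size", DawarWilsenach2025 p. 18)] -/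
theorem ncard_orbit_reduce_le [Fintype ι] {P : Set (ι → ι)} (hcov : ∀ π ∈ P, ∃ a ∈ A, (⇑a.1 : ι → ι) = π)
    {s : ℕ} (hs : ∀ l : Λ, (traced A l).ncard ≤ s) (g : D.RGate) :
    (D.reduce.orbit P g).ncard ≤ max s (Fintype.card ι) := by
  rcases g with q | ⟨w, k, hk⟩
  · rw [← Quotient.out_eq q]
    exact ((ncard_orbit_reduce_inl_le A hA hcov q.out).trans (hs _)).trans (le_max_left _ _)
  · rcases w with i | q
    · exact (ncard_orbit_reduce_chain_inl_le A hA hcov i k hk).trans (le_max_right _ _)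
    · have key : ∀ (q : D.CQ) (k : Fin (D.mult (Sum.inr q))) (hk : 1 ≤ (k : ℕ)),
          (D.reduce.orbit P (Sum.inr ⟨Sum.inr q, k, hk⟩)).ncard ≤ max s (Fintype.card ι) := by
        intro q
        rw [← Quotient.out_eq q]
        intro k hk
        exact ((ncard_orbit_reduce_chain_cls_le A hA hcov q.out k hk).trans (hs _)).trans (le_max_left _ _)
      exact key q k hk

end Orbits


end Reduce

end GateDAG

/-! ### Rigidification of symmetric straight-line threshold circuits ([2, Lemma 7]) -/

/-- `∧₁` belongs to the threshold basis. [folklore] -/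
theorem and_one_mem_tcBasis : GateFn.and 1 ∈ tcBasis :=
  acBasis_subset_tcBasis (Or.inr (Set.mem_iUnion.2 ⟨1, Or.inl rfl⟩))

/-- **Rigidification of symmetric threshold circuits (Anderson–Dawar 2017, Lemma 7), in the form
used by Dawar–Wilsenach 2025, p. 18** ("any symmetric Boolean circuit over the threshold basis may
be converted into an equivalent rigid symmetric circuit … the conversion does not increase orbit
size"), for the tree's straight-line circuits on `n × n` matrix inputs: every `Sym(Fin n)`-symmetric
`tcBasis`-circuit has a RIGID, simply wired, `Sym(Fin n)`-symmetric `tcBasis`-circuit computing the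
same function, whose orbit size exceeds the old one by at most `n²` (the orbits of the `∧₁`-chains
attached to input wires; in print inputs are gates and these orbits are already counted). This is
exactly the hypothesis `hrig` of
`Literature.ModelTheory.FiniteModelTheory.DawarWilsenach2025_orbitSize_countingWidth.of_rigidification_of_supportTheorem`.
Construction: `GateDAG.reduce` of the DAG of `C`, compiled back to a program.
[cite: AndersonDawar2016, Lemma 7; DawarWilsenach2025, §6 p. 18] -/
theorem Circuit.exists_rigid_of_isSymmetricUnder {n : ℕ} (C : Circuit (Fin n × Fin n))
    (hB : C.IsOver tcBasis) (hsym : C.IsSymmetricUnder Set.univ) :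
    ∃ C' : Circuit (Fin n × Fin n), C'.IsOver tcBasis ∧ C'.IsSymmetricUnder Set.univ ∧
      C'.IsRigid ∧ C'.HasSimpleWiring ∧ (∀ x, C'.eval x = C.eval x) ∧
      C'.orbitSize Set.univ ≤ C.orbitSize Set.univ + n ^ 2 := by
  let D := GateDAG.ofCircuit C
  have hfB : ∀ l, D.fn l ∈ tcBasis := (GateDAG.isOver_iff_ofCircuit C _).1 hB
  have hfs : ∀ l, (D.fn l).IsSymmetric := fun l => isSymmetric_of_mem_tcBasis (hfB l)
  have hDs : D.IsSymm (GateDAG.diagMaps Set.univ) := (GateDAG.isSymmetricUnder_iff_ofCircuit C _).1 hsym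
  -- the diagonal map of `ρ` as a permutation of the inputs
  have hdiag : ∀ ρ : Equiv.Perm (Fin n),
      (⇑(Equiv.prodCongr ρ ρ) : Fin n × Fin n → Fin n × Fin n) = fun q => (ρ q.1, ρ q.2) :=
    fun ρ => funext fun q => rfl
  -- the chosen automorphisms of `D`: all automorphisms over diagonal maps
  let A : Set (Equiv.Perm (Fin n × Fin n) × (Fin C.gates.length ≃ Fin C.gates.length)) :=
    {a | D.IsAut (⇑a.1) a.2 ∧ ∃ ρ : Equiv.Perm (Fin n), a.1 = Equiv.prodCongr ρ ρ}
  have hA : ∀ a ∈ A, D.IsAut (⇑a.1) a.2 := fun a ha => ha.1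
  have hcov : ∀ π ∈ GateDAG.diagMaps (Set.univ : Set (Equiv.Perm (Fin n))), ∃ a ∈ A,
      (⇑a.1 : Fin n × Fin n → Fin n × Fin n) = π := by
    rintro π ⟨ρ, -, rfl⟩
    obtain ⟨θ, hθ⟩ := hDs _ (GateDAG.diag_mem_diagMaps (Set.mem_univ ρ))
    refine ⟨(Equiv.prodCongr ρ ρ, θ), ⟨?_, ρ, rfl⟩, hdiag ρ⟩
    show D.IsAut (⇑(Equiv.prodCongr ρ ρ)) θ
    rw [hdiag]; exact hθ
  refine ⟨D.reduce.compile, ?_, ?_, ?_, ?_, ?_, ?_⟩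
  · exact D.reduce.compile_isOver (D.reduce_fn_mem hfB and_one_mem_tcBasis)
  · rw [GateDAG.isSymmetricUnder_compile_iff]
    intro π hπ
    obtain ⟨a, ha, rfl⟩ := hcov π hπ
    exact ⟨_, (hA a ha).reduce⟩
  · exact D.reduce.compile_isRigid D.isRigidDAG_reduce
  · exact D.reduce.compile_hasSimpleWiring D.reduce_args_injective
  · intro x
    rw [GateDAG.compile_eval, GateDAG.evalOut_reduce _ hfs, GateDAG.evalOut_ofCircuit]
  · refine D.reduce.orbitSize_compile_le _ fun g => ?_
    have hs : ∀ l, (GateDAG.traced A l).ncard ≤ C.orbitSize Set.univ := by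
      intro l
      refine le_trans (Set.ncard_le_ncard (GateDAG.traced_subset_orbit A (P := GateDAG.diagMaps Set.univ)
        (fun a ha => ⟨ha.1, ?_⟩) l) (Set.toFinite _)) ?_
      · obtain ⟨ρ, hρ⟩ := ha.2
        exact ⟨ρ, Set.mem_univ ρ, by rw [hρ, hdiag]⟩
      · rw [← GateDAG.gateOrbit_eq_orbit_ofCircuit]
        exact C.ncard_gateOrbit_le_orbitSize _ l
    refine (GateDAG.ncard_orbit_reduce_le A hA hcov hs g).trans (max_le (Nat.le_add_right _ _) ?_)
    rw [Fintype.card_prod, Fintype.card_fin, sq]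
    exact Nat.le_add_left _ _

/-- The same, in the exact hypothesis shape of
`DawarWilsenach2025_orbitSize_countingWidth.of_rigidification_of_supportTheorem` (with the
unused simple-wiring hypothesis on the INPUT circuit). [cite: AndersonDawar2016, Lemma 7; DawarWilsenach2025, §6 p. 18] -/
theorem Circuit.rigidification_tcBasis :
    ∀ (n : ℕ) (C : Circuit (Fin n × Fin n)), C.IsOver tcBasis →
      C.IsSymmetricUnder Set.univ → C.HasSimpleWiring →
      ∃ C' : Circuit (Fin n × Fin n), C'.IsOver tcBasis ∧ C'.IsSymmetricUnder Set.univ ∧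
        C'.IsRigid ∧ C'.HasSimpleWiring ∧ (∀ x, C'.eval x = C.eval x) ∧
        C'.orbitSize Set.univ ≤ C.orbitSize Set.univ + n ^ 2 :=
  fun _ C hB hsym _ => C.exists_rigid_of_isSymmetricUnder hB hsym

end Literature.Computability.Complexity
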